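import Summits.HodgeConjecture.CorCM.StabiliserOrbitDoubleFlipReflex
import HarnessLib

/-!
# An OCTIC CM field with double flips and even conjugate distances against its OCTIC reflex field: the pair is ALWAYS
# additive — `Hg(A₀ × A₁) = Hg(A₀) × Hg(A₁)` for every pair of types (`W(D₄)`-octics and their triality twins)

COR-CM (cell `pub-hodgecm2`, binder seat `b16` gen 53, count-neutral claim ORBIT-CRITERION, file F10 — abstract counting
(§1) and CM fields / abelian varieties (§2–§3); theorems only, no definition, no named fact, no `sorry`).  NEW as stated,
hence under `Summits/`.  HONEST FRAMING: unconditional statements about pairs of CM types and products of CM abelian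
varieties; `HC_CM` is neither used nor asserted.

F8/F9 (`StabiliserOrbitDoubleFlipReflexSlot`, `StabiliserOrbitDoubleFlipReflex`) decided a double-flip base with even
conjugate distances (EV) against its (half-degree) reflex field by the INCIDENCE NUMBERS `N(x) = #{y ∈ Φ₁ : x ∈ T y}`:
exceptional iff `N` is `a` on `Φ₀`, `b` off `Φ₀`, `a ≠ b`.  When BOTH slots have 8 embeddings (an octic base of Galois
group `W(D₄)` — or an order-96 transitive subgroup containing the even sign kernel — against its OCTIC reflex field) this
never happens, by a parity count on the even 4-cube:

* §1 (abstract, ns `ReflexSlot`) `two_mul_card_filter_mem_of_isCMTypeWith` (a CM type is half the slot);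
  **`not_exists_incidence_of_card_eight`**: `|Z| = |Y| = 8`, `T` a type map, (EV) against `Φ₀`, `Ψ ⊆ Y` any CM type ⟹ the
  incidence numbers of `Ψ` are NOT constant-unequal.  PROOF: `N(x) + N(ρx) = #Ψ = 4` gives `a + b = 4`; with
  `c(y) = #(Φ₀ ∩ T y)` one has `Σ_{x∈Φ₀} N(x) = Σ_{y∈Ψ} c(y) = 4a` (double count); `c(y)` is even (EV), `= 4` only for
  `y = y₀` and `= 0` only for `y = ρy₀`, so `c = 2` on the three members of `Ψ` other than its member of `{y₀, ρy₀}`, whence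
  `Σ_{y∈Ψ} c(y) ∈ {6, 10}` — not a multiple of `4`.
* §2 (CM fields) **`cmFamilyRank_add_card_eq_of_doubleFlip_reflexOctic`** — `[K_{i₀}:ℚ] = 8` with double flips and (EV),
  `ψ₀` a reflex embedding of an OCTIC `K_{i₁}`: `rank(Φ₀, Φ₁) + 2 = rank Φ₀ + rank Φ₁ + 1` for EVERY pair of types
  (`Hg(A₀ × A₁) = Hg(A₀) × Hg(A₁)`); **`isNondegenerateFamily_iff_of_doubleFlip_reflexOctic`**: nondegenerate IFF `Φ₁` is.
* §3 (abelian varieties) **`hodgeConjectureFor_prod_of_doubleFlip_reflexOctic`** (HC with `B• = D•` on every `A₀^a × A₁^b`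
  when `Φ₁` is nondegenerate — unconditionally), **`forall_prod_hodgeClassSpan_eq_iff_of_doubleFlip_reflexOctic`** (simple
  non-isogenous fourfolds: `B• = D•` on all products IFF `A₁` has no Weil-type degeneracy, i.e. `Φ₁` nondegenerate).
A new cell of the `(4,4)` census: a CM fourfold whose octic field has Galois group `W(D₄)` times a CM fourfold of the
reflex (triality-twin) octic — no common subfield condition, not a companion pair.

## References

* [Dodson1984] B. Dodson, *The structure of Galois groups of CM-fields*, Trans. AMS 283 (1984), §1 (Reflex Degree
  Theorem), §5.1, §5.2 (the imprimitive octic structures and their reflex degrees).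
* [Shimura1998] G. Shimura, *Abelian Varieties with Complex Multiplication and Modular Functions*, §8.3 Prop. 28.
* [Gordon1999HodgeAVSurvey] B. B. Gordon, *A survey of the Hodge conjecture for abelian varieties*, §3 Theorem, 7.5–7.7,
  9.4.3, 10.10.
-/

set_option autoImplicit false

noncomputable section

open scoped BigOperators

universe u

namespace Summit.HodgeConjecture.CorCM

namespace ReflexSlot

open Literature.NumberTheory.ComplexMultiplication
open scoped Classical

variable {G : Type u} [Group G]

/-! ### §1 The parity count on the even 4-cube -/

/-- **A CM type is half the slot**: `2 · #Φ = |W|`. [cite: Shimura1998, §8.3 Prop. 28] -/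
theorem two_mul_card_filter_mem_of_isCMTypeWith {W : Type*} [Fintype W] [MulAction G W] {ρ : G} {Φ : Set W}
    (h : IsCMTypeWith ρ Φ) : 2 * (Finset.univ.filter fun w : W => w ∈ Φ).card = Fintype.card W := by
  have himage : (Finset.univ.filter fun w : W => w ∈ Φ).image (fun w => ρ • w) =
      Finset.univ.filter fun w : W => ¬ w ∈ Φ := by
    ext w
    simp only [Finset.mem_image, Finset.mem_filter, Finset.mem_univ, true_and]
    constructor
    · rintro ⟨v, hv, rfl⟩
      exact (h.mem_iff v).1 hv
    · intro hw
      exact ⟨ρ • w, (h.rho_smul_mem_iff w).2 hw, h.invol w⟩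
  have hcard := Finset.card_filter_add_card_filter_not (s := (Finset.univ : Finset W)) (fun w => w ∈ Φ)
  rw [← himage, Finset.card_image_of_injective _ (MulAction.injective ρ), Finset.card_univ] at hcard
  omega

variable {Z Y : Type*} [MulAction G Z] [MulAction G Y] [Fintype Z] [Fintype Y] {ρ : G} {Φ₀ : Set Z}
  {T : Y → Set Z} {y₀ : Y}

/-- **On the even 4-cube the incidence numbers are never constant-unequal.**  `|Z| = |Y| = 8`, `T` a type map with
`T y₀ = Φ₀`, every `T y` at even Hamming distance from `Φ₀`, `Ψ ⊆ Y` a CM type: there are no `a ≠ b` with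
`#{y ∈ Ψ : x ∈ T y} = a` on `Φ₀` and `= b` off `Φ₀`. [cite: Dodson1984, §5.1 and §5.2] [cite: Gordon1999HodgeAVSurvey, 9.4.3] -/
theorem not_exists_incidence_of_card_eight (hΦ : IsCMTypeWith ρ Φ₀)
    (hT : ∀ (g : G) (y : Y) (x : Z), x ∈ T (g • y) ↔ g⁻¹ • x ∈ T y) (hTi : Function.Injective T)
    (hT₀ : T y₀ = Φ₀) (hY : ∀ y : Y, ∃ g : G, g • y₀ = y)
    (heven : ∀ y : Y, Even (Finset.univ.filter fun x : Z => x ∈ T y₀ ∧ x ∉ T y).card)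
    (hZ : Fintype.card Z = 8) (hYc : Fintype.card Y = 8) {Ψ : Set Y} (hΨ : ∀ y : Y, y ∈ Ψ ↔ ρ • y ∉ Ψ) :
    ¬ ∃ a b : ℕ, a ≠ b ∧ ∀ x : Z,
      (Finset.univ.filter fun y : Y => y ∈ Ψ ∧ x ∈ T y).card = if x ∈ Φ₀ then a else b := by
  rintro ⟨a, b, hab, hN⟩
  have hΨcm : IsCMTypeWith ρ Ψ := isCMTypeWith_of_mem_iff hΦ hT hTi hΨ
  have hTy : ∀ y : Y, IsCMTypeWith ρ (T y) := isCMTypeWith_typeMap hΦ hT hT₀ hY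
  have cΦ : (Finset.univ.filter fun x : Z => x ∈ Φ₀).card = 4 := by
    have := two_mul_card_filter_mem_of_isCMTypeWith hΦ; omega
  have cΨ : (Finset.univ.filter fun y : Y => y ∈ Ψ).card = 4 := by
    have := two_mul_card_filter_mem_of_isCMTypeWith hΨcm; omega
  -- Step 1: `a + b = 4` from `N(x) + N(ρx) = #Ψ`
  obtain ⟨x₁, hx₁⟩ : ∃ x : Z, x ∈ Φ₀ := by
    by_contra hno
    push Not at hno
    have h0 : (Finset.univ.filter fun x : Z => x ∈ Φ₀).card = 0 :=
      Finset.card_eq_zero.2 (Finset.filter_eq_empty_iff.2 fun x _ => hno x)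
    omega
  have hsum4 : a + b = 4 := by
    have h1 := hN x₁
    have h2 := hN (ρ • x₁)
    rw [if_pos hx₁] at h1
    rw [if_neg ((hΦ.mem_iff x₁).1 hx₁)] at h2
    have hsplit := Finset.card_filter_add_card_filter_not (s := Finset.univ.filter fun y : Y => y ∈ Ψ)
      (fun y : Y => x₁ ∈ T y)
    rw [Finset.filter_filter, Finset.filter_filter, cΨ] at hsplit
    have hρ : (Finset.univ.filter fun y : Y => y ∈ Ψ ∧ ρ • x₁ ∈ T y) =
        Finset.univ.filter fun y : Y => y ∈ Ψ ∧ ¬ x₁ ∈ T y := by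
      refine Finset.filter_congr fun y _ => ?_
      rw [rho_smul_mem_typeMap_iff hΦ hT hT₀ hY y x₁]
    rw [hρ] at h2
    omega
  -- Step 2: the counts `c(y) = #(Φ₀ ∩ T y)`
  have hc_le : ∀ y : Y, (Finset.univ.filter fun x : Z => x ∈ Φ₀ ∧ x ∈ T y).card ≤ 4 := by
    intro y
    rw [← cΦ]
    exact Finset.card_le_card (fun x hx => by
      rw [Finset.mem_filter] at hx ⊢; exact ⟨hx.1, hx.2.1⟩)
  have hc_even : ∀ y : Y, Even (Finset.univ.filter fun x : Z => x ∈ Φ₀ ∧ x ∈ T y).card := by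
    intro y
    have hsplit := Finset.card_filter_add_card_filter_not (s := Finset.univ.filter fun x : Z => x ∈ Φ₀)
      (fun x : Z => x ∈ T y)
    rw [Finset.filter_filter, Finset.filter_filter, cΦ] at hsplit
    have hev := heven y
    rw [hT₀] at hev
    obtain ⟨m, hm⟩ := hev
    refine ⟨2 - m, ?_⟩
    have hm4 : m + m ≤ 4 := by rw [← hm]; omega
    omega
  have hc_four : ∀ y : Y, (Finset.univ.filter fun x : Z => x ∈ Φ₀ ∧ x ∈ T y).card = 4 → y = y₀ := by
    intro y hy
    have heq : (Finset.univ.filter fun x : Z => x ∈ Φ₀ ∧ x ∈ T y) = Finset.univ.filter fun x : Z => x ∈ Φ₀ :=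
      Finset.eq_of_subset_of_card_le (fun x hx => by rw [Finset.mem_filter] at hx ⊢; exact ⟨hx.1, hx.2.1⟩)
        (by rw [cΦ, hy])
    have hsub : ∀ x : Z, x ∈ Φ₀ → x ∈ T y := by
      intro x hx
      have hmem : x ∈ Finset.univ.filter fun x : Z => x ∈ Φ₀ := Finset.mem_filter.2 ⟨Finset.mem_univ _, hx⟩
      rw [← heq, Finset.mem_filter] at hmem
      exact hmem.2.2
    apply hTi
    rw [hT₀]
    ext x
    constructor
    · intro hx
      by_contra hx'
      have h1 : ρ • x ∈ Φ₀ := (hΦ.rho_smul_mem_iff x).2 hx'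
      exact (rho_smul_mem_typeMap_iff hΦ hT hT₀ hY y x).1 (hsub _ h1) hx
    · exact hsub x
  have hc_zero : ∀ y : Y, (Finset.univ.filter fun x : Z => x ∈ Φ₀ ∧ x ∈ T y).card = 0 → y = ρ • y₀ := by
    intro y hy
    have hno : ∀ x : Z, x ∈ Φ₀ → x ∉ T y := by
      intro x hx hxy
      have hmem : x ∈ Finset.univ.filter fun x : Z => x ∈ Φ₀ ∧ x ∈ T y :=
        Finset.mem_filter.2 ⟨Finset.mem_univ _, hx, hxy⟩
      rw [Finset.card_eq_zero] at hy
      rw [hy] at hmem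
      exact Finset.notMem_empty _ hmem
    have h4 : (Finset.univ.filter fun x : Z => x ∈ Φ₀ ∧ x ∈ T (ρ • y)).card = 4 := by
      have heq : (Finset.univ.filter fun x : Z => x ∈ Φ₀ ∧ x ∈ T (ρ • y)) =
          Finset.univ.filter fun x : Z => x ∈ Φ₀ := by
        refine Finset.filter_congr fun x _ => ⟨fun h => h.1, fun h => ⟨h, ?_⟩⟩
        exact (mem_typeMap_rho_smul_iff hΦ hT hT₀ hY y x).2 (hno x h)
      rw [heq, cΦ]
    have h := hc_four (ρ • y) h4
    rw [← h, rho_smul_rho_smul hΦ hT hTi]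
  -- Step 3: the distinguished member `y*` of `Ψ` in `{y₀, ρy₀}` and `c = 2` elsewhere on `Ψ`
  obtain ⟨ys, hysΨ, hys, hcys⟩ : ∃ ys : Y, ys ∈ Ψ ∧ (ys = y₀ ∨ ys = ρ • y₀) ∧
      ((Finset.univ.filter fun x : Z => x ∈ Φ₀ ∧ x ∈ T ys).card = 4 ∨
        (Finset.univ.filter fun x : Z => x ∈ Φ₀ ∧ x ∈ T ys).card = 0) := by
    have c0 : (Finset.univ.filter fun x : Z => x ∈ Φ₀ ∧ x ∈ T y₀).card = 4 := by
      have heq : (Finset.univ.filter fun x : Z => x ∈ Φ₀ ∧ x ∈ T y₀) = Finset.univ.filter fun x : Z => x ∈ Φ₀ := by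
        refine Finset.filter_congr fun x _ => ⟨fun h => h.1, fun h => ⟨h, by rw [hT₀]; exact h⟩⟩
      rw [heq, cΦ]
    have cρ : (Finset.univ.filter fun x : Z => x ∈ Φ₀ ∧ x ∈ T (ρ • y₀)).card = 0 := by
      refine Finset.card_eq_zero.2 (Finset.filter_eq_empty_iff.2 fun x _ hx => ?_)
      rw [mem_typeMap_rho_smul_iff hΦ hT hT₀ hY y₀ x, hT₀] at hx
      exact hx.2 hx.1
    by_cases h0 : y₀ ∈ Ψ
    · exact ⟨y₀, h0, Or.inl rfl, Or.inl c0⟩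
    · exact ⟨ρ • y₀, by rwa [(hΨcm.rho_smul_mem_iff y₀)], Or.inr rfl, Or.inr cρ⟩
  have hc_two : ∀ y : Y, y ∈ Ψ → y ≠ ys → (Finset.univ.filter fun x : Z => x ∈ Φ₀ ∧ x ∈ T y).card = 2 := by
    intro y hyΨ hne
    have hle := hc_le y
    obtain ⟨m, hm⟩ := hc_even y
    have hne4 : (Finset.univ.filter fun x : Z => x ∈ Φ₀ ∧ x ∈ T y).card ≠ 4 := by
      intro h4
      have hyy := hc_four y h4
      rcases hys with rfl | rfl
      · exact hne hyy
      · rw [hyy] at hyΨ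
        exact (hΨ y₀).1 hyΨ hysΨ
    have hne0 : (Finset.univ.filter fun x : Z => x ∈ Φ₀ ∧ x ∈ T y).card ≠ 0 := by
      intro h0
      have hyy := hc_zero y h0
      rcases hys with rfl | rfl
      · rw [hyy] at hyΨ
        exact (hΨcm.rho_smul_mem_iff _).1 hyΨ hysΨ
      · exact hne hyy
    omega
  -- Step 4: the double count `Σ_{x ∈ Φ₀} N(x) = Σ_{y ∈ Ψ} c(y)` equals `4a` and lies in `{6, 10}`
  have hdc : ∑ x ∈ Finset.univ.filter (fun x : Z => x ∈ Φ₀),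
      (Finset.univ.filter fun y : Y => y ∈ Ψ ∧ x ∈ T y).card =
        ∑ y ∈ Finset.univ.filter (fun y : Y => y ∈ Ψ),
          (Finset.univ.filter fun x : Z => x ∈ Φ₀ ∧ x ∈ T y).card := by
    have hL : ∑ x ∈ Finset.univ.filter (fun x : Z => x ∈ Φ₀),
        (Finset.univ.filter fun y : Y => y ∈ Ψ ∧ x ∈ T y).card =
          ∑ x, ∑ y, (if x ∈ Φ₀ ∧ (y ∈ Ψ ∧ x ∈ T y) then 1 else 0) := by
      rw [Finset.sum_filter]
      refine Finset.sum_congr rfl fun x _ => ?_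
      rw [Finset.card_filter]
      split_ifs with hx
      · refine Finset.sum_congr rfl fun y _ => ?_
        simp only [hx, true_and]
      · symm
        refine Finset.sum_eq_zero fun y _ => ?_
        simp only [hx, false_and, if_false]
    have hR : ∑ y ∈ Finset.univ.filter (fun y : Y => y ∈ Ψ),
        (Finset.univ.filter fun x : Z => x ∈ Φ₀ ∧ x ∈ T y).card =
          ∑ y, ∑ x, (if x ∈ Φ₀ ∧ (y ∈ Ψ ∧ x ∈ T y) then 1 else 0) := by
      rw [Finset.sum_filter]
      refine Finset.sum_congr rfl fun y _ => ?_
      rw [Finset.card_filter]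
      split_ifs with hy
      · refine Finset.sum_congr rfl fun x _ => ?_
        simp only [hy, true_and]
      · symm
        refine Finset.sum_eq_zero fun x _ => ?_
        simp only [hy, false_and, and_false, if_false]
    rw [hL, hR, Finset.sum_comm]
  have hlhs : ∑ x ∈ Finset.univ.filter (fun x : Z => x ∈ Φ₀),
      (Finset.univ.filter fun y : Y => y ∈ Ψ ∧ x ∈ T y).card = 4 * a := by
    rw [Finset.sum_const_nat (m := a) fun x hx => ?_, cΦ]
    rw [hN x, if_pos (Finset.mem_filter.1 hx).2]
  have hys_mem : ys ∈ Finset.univ.filter fun y : Y => y ∈ Ψ := Finset.mem_filter.2 ⟨Finset.mem_univ _, hysΨ⟩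
  have hrhs : ∑ y ∈ Finset.univ.filter (fun y : Y => y ∈ Ψ),
      (Finset.univ.filter fun x : Z => x ∈ Φ₀ ∧ x ∈ T y).card =
        (Finset.univ.filter fun x : Z => x ∈ Φ₀ ∧ x ∈ T ys).card + 3 * 2 := by
    rw [← Finset.add_sum_erase _ _ hys_mem]
    congr 1
    have hcard3 : ((Finset.univ.filter fun y : Y => y ∈ Ψ).erase ys).card = 3 := by
      rw [Finset.card_erase_of_mem hys_mem, cΨ]
    rw [Finset.sum_const_nat (m := 2) fun y hy => ?_, hcard3]
    rw [Finset.mem_erase, Finset.mem_filter] at hy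
    exact hc_two y hy.2.2 hy.1
  rw [hdc, hrhs] at hlhs
  rcases hcys with h4 | h0
  · rw [h4] at hlhs; omega
  · rw [h0] at hlhs; omega

end ReflexSlot

/-! ### §2 CM fields: an octic double-flip field against its octic reflex field -/

open CategoryTheory CategoryTheory.Limits NumberField Module
open Literature.NumberTheory.ComplexMultiplication
open Literature.AlgebraicGeometry.Motives (AbelianVariety CMType)
open Literature.AlgebraicGeometry.HodgeTheory
open Literature.AlgebraicGeometry.ComplexMultiplication (IsCMTypeRealisation)
open Literature.AlgebraicGeometry.VanGeemen1994 (hodgeClassSpan)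
open Literature.AlgebraicGeometry.Pohlmann1968
open Literature.Barriers.HodgeConjecture (divisorClassesSpan)
open scoped Classical

variable {I : Type} {K : I → Type} [∀ i, Field (K i)] [∀ i, NumberField (K i)] [∀ i, IsCMField (K i)] [Fintype I]
  [DecidableEq I] {Φ : ∀ i, CMType (K i)} {i₀ i₁ : I}

section Types

/-- **OCTIC DOUBLE-FLIP FIELD × ITS OCTIC REFLEX FIELD IS ALWAYS ADDITIVE.**  `I = {i₀, i₁}`, `[K_{i₀}:ℚ] = 8` with double
flips and (EV), `ψ₀` a reflex embedding of `K_{i₁}` for `Φ₀` with `[K_{i₁}:ℚ] = 8`: for EVERY pair of types,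
`rank(Φ₀, Φ₁) + 2 = rank Φ₀ + rank Φ₁ + 1` (`Hg(A₀ × A₁) = Hg(A₀) × Hg(A₁)`).
[cite: Gordon1999HodgeAVSurvey, §3 Theorem (1), 7.5–7.7 and 9.4.3] [cite: Dodson1984, §5.1 and §5.2] [cite: Shimura1998, §8.3 Prop. 28] -/
theorem cmFamilyRank_add_card_eq_of_doubleFlip_reflexOctic (hI : ∀ i, i = i₀ ∨ i = i₁) (h01 : i₀ ≠ i₁)
    (h8 : finrank ℚ (K i₀) = 8) (h8' : finrank ℚ (K i₁) = 8)
    (hflip : ∀ s t : K i₀ →+* ℂ, t ≠ s → t ≠ (starRingAut : ℂ ≃+* ℂ) • s → ∃ σ : ℂ ≃+* ℂ,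
      σ • s = (starRingAut : ℂ ≃+* ℂ) • s ∧ σ • t = (starRingAut : ℂ ≃+* ℂ) • t ∧
      ∀ u : K i₀ →+* ℂ, u ≠ s → u ≠ (starRingAut : ℂ ≃+* ℂ) • s → u ≠ t → u ≠ (starRingAut : ℂ ≃+* ℂ) • t →
        σ • u = u)
    (heven : ∀ τ : ℂ ≃+* ℂ,
      Even (Finset.univ.filter fun x : K i₀ →+* ℂ => x ∈ (Φ i₀).1 ∧ τ • x ∉ (Φ i₀).1).card)
    {ψ₀ : K i₁ →+* ℂ}
    (hψ₀ : ∀ σ : ℂ ≃+* ℂ, σ • ψ₀ = ψ₀ ↔ ∀ x : K i₀ →+* ℂ, σ • x ∈ (Φ i₀).1 ↔ x ∈ (Φ i₀).1) :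
    CMAlgebra.cmFamilyRank Φ + Fintype.card I = (∑ i, cmTypeRank (Φ i)) + 1 := by
  obtain ⟨T, hT, hTi, hT₀, hY, hmem⟩ := exists_typeMap_of_reflexEmbedding (Φ i₀) hψ₀
  refine (cmFamilyRank_add_card_eq_iff_of_doubleFlip_of_reflexEmbedding hI h01 (by omega) hflip heven hψ₀).2 ?_
  have hZ : Fintype.card (K i₀ →+* ℂ) = 8 := by rw [Embeddings.card, h8]
  have hYc : Fintype.card (K i₁ →+* ℂ) = 8 := by rw [Embeddings.card, h8']
  have hev := ReflexSlot.even_card_typeMap_diff_of_even_conj hT hT₀ hY heven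
  have key := ReflexSlot.not_exists_incidence_of_card_eight (G := ℂ ≃+* ℂ) (isCMTypeWith_conj (Φ i₀)) hT hTi hT₀ hY
    (fun y => hev ψ₀ y) hZ hYc (Ψ := (Φ i₁).1) (isCMTypeWith_conj (Φ i₁)).mem_iff
  simp only [hmem] at key
  exact key

/-- **OCTIC DOUBLE-FLIP FIELD × ITS OCTIC REFLEX FIELD: nondegenerate IFF `Φ₁` is nondegenerate.**
[cite: Gordon1999HodgeAVSurvey, 7.5–7.7] [cite: Dodson1984, §5.1 and §5.2] [cite: Shimura1998, §8.3 Prop. 28] -/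
theorem isNondegenerateFamily_iff_of_doubleFlip_reflexOctic (hI : ∀ i, i = i₀ ∨ i = i₁) (h01 : i₀ ≠ i₁)
    (h8 : finrank ℚ (K i₀) = 8) (h8' : finrank ℚ (K i₁) = 8)
    (hflip : ∀ s t : K i₀ →+* ℂ, t ≠ s → t ≠ (starRingAut : ℂ ≃+* ℂ) • s → ∃ σ : ℂ ≃+* ℂ,
      σ • s = (starRingAut : ℂ ≃+* ℂ) • s ∧ σ • t = (starRingAut : ℂ ≃+* ℂ) • t ∧
      ∀ u : K i₀ →+* ℂ, u ≠ s → u ≠ (starRingAut : ℂ ≃+* ℂ) • s → u ≠ t → u ≠ (starRingAut : ℂ ≃+* ℂ) • t →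
        σ • u = u)
    (heven : ∀ τ : ℂ ≃+* ℂ,
      Even (Finset.univ.filter fun x : K i₀ →+* ℂ => x ∈ (Φ i₀).1 ∧ τ • x ∉ (Φ i₀).1).card)
    {ψ₀ : K i₁ →+* ℂ}
    (hψ₀ : ∀ σ : ℂ ≃+* ℂ, σ • ψ₀ = ψ₀ ↔ ∀ x : K i₀ →+* ℂ, σ • x ∈ (Φ i₀).1 ↔ x ∈ (Φ i₀).1) :
    CMAlgebra.IsNondegenerateFamily Φ ↔ IsNondegenerate (Φ i₁) := by
  obtain ⟨T, hT, hTi, hT₀, hY, hmem⟩ := exists_typeMap_of_reflexEmbedding (Φ i₀) hψ₀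
  rw [isNondegenerateFamily_iff_of_doubleFlip_of_reflexEmbedding hI h01 (by omega) hflip heven hψ₀]
  refine ⟨fun h => h.1, fun hnd => ⟨hnd, ?_⟩⟩
  have hZ : Fintype.card (K i₀ →+* ℂ) = 8 := by rw [Embeddings.card, h8]
  have hYc : Fintype.card (K i₁ →+* ℂ) = 8 := by rw [Embeddings.card, h8']
  have hev := ReflexSlot.even_card_typeMap_diff_of_even_conj hT hT₀ hY heven
  have key := ReflexSlot.not_exists_incidence_of_card_eight (G := ℂ ≃+* ℂ) (isCMTypeWith_conj (Φ i₀)) hT hTi hT₀ hY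
    (fun y => hev ψ₀ y) hZ hYc (Ψ := (Φ i₁).1) (isCMTypeWith_conj (Φ i₁)).mem_iff
  simp only [hmem] at key
  exact key

end Types

/-! ### §3 Abelian varieties -/

section Varieties

variable [Nonempty I] {A : I → AbelianVariety ℂ} {ι : ∀ i, 𝓞 (K i) →+* End (A i)}
  {θ : ∀ i, K i →+* Module.End ℂ (complexBetti (A i).X 1)}

/-- **The Hodge conjecture on every `A₀^a × A₁^b`** (every `⨁_{j<N} A_{π j}`), with `B• = D•` there, for a CM fourfold `A₀`
whose octic field has double flips and (EV) and a CM fourfold `A₁` of its octic reflex field realising a NONDEGENERATE type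
— UNCONDITIONALLY. [cite: Gordon1999HodgeAVSurvey, 7.5 and 10.10] -/
theorem hodgeConjectureFor_prod_of_doubleFlip_reflexOctic (hI : ∀ i, i = i₀ ∨ i = i₁) (h01 : i₀ ≠ i₁)
    (h8 : finrank ℚ (K i₀) = 8) (h8' : finrank ℚ (K i₁) = 8)
    (hflip : ∀ s t : K i₀ →+* ℂ, t ≠ s → t ≠ (starRingAut : ℂ ≃+* ℂ) • s → ∃ σ : ℂ ≃+* ℂ,
      σ • s = (starRingAut : ℂ ≃+* ℂ) • s ∧ σ • t = (starRingAut : ℂ ≃+* ℂ) • t ∧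
      ∀ u : K i₀ →+* ℂ, u ≠ s → u ≠ (starRingAut : ℂ ≃+* ℂ) • s → u ≠ t → u ≠ (starRingAut : ℂ ≃+* ℂ) • t →
        σ • u = u)
    (heven : ∀ τ : ℂ ≃+* ℂ,
      Even (Finset.univ.filter fun x : K i₀ →+* ℂ => x ∈ (Φ i₀).1 ∧ τ • x ∉ (Φ i₀).1).card)
    {ψ₀ : K i₁ →+* ℂ}
    (hψ₀ : ∀ σ : ℂ ≃+* ℂ, σ • ψ₀ = ψ₀ ↔ ∀ x : K i₀ →+* ℂ, σ • x ∈ (Φ i₀).1 ↔ x ∈ (Φ i₀).1)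
    (hnd : IsNondegenerate (Φ i₁)) (hA : ∀ i, IsCMTypeRealisation (Φ i) (A i) (ι i) (θ i)) {N : ℕ} (π : Fin N → I) :
    HodgeConjectureFor (⨁ fun j : Fin N => A (π j)).dim (⨁ fun j : Fin N => A (π j)).X ∧
      ∀ m : ℕ, hodgeClassSpan (⨁ fun j : Fin N => A (π j)).dim (⨁ fun j : Fin N => A (π j)).X m =
        divisorClassesSpan (⨁ fun j : Fin N => A (π j)).X (⨁ fun j : Fin N => A (π j)).dim m :=
  have h := (isNondegenerateFamily_iff_of_doubleFlip_reflexOctic hI h01 h8 h8' hflip heven hψ₀).2 hnd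
  ⟨h.hodgeConjectureFor_prod hA π, fun m => h.hodgeClassSpan_prod_eq_divisorClassesSpan hA π m⟩

/-- **SIMPLE, NON-ISOGENOUS fourfolds (octic double-flip field with (EV) × its octic reflex field): `B• = D•` on ALL products
`A₀^a × A₁^b` IFF `Φ₁` is nondegenerate** — the only exceptional classes are those of `A₁` itself (Weil type).
[cite: Gordon1999HodgeAVSurvey, 7.5 and 7.6.1] -/
theorem forall_prod_hodgeClassSpan_eq_iff_of_doubleFlip_reflexOctic (hI : ∀ i, i = i₀ ∨ i = i₁) (h01 : i₀ ≠ i₁)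
    (h8 : finrank ℚ (K i₀) = 8) (h8' : finrank ℚ (K i₁) = 8)
    (hflip : ∀ s t : K i₀ →+* ℂ, t ≠ s → t ≠ (starRingAut : ℂ ≃+* ℂ) • s → ∃ σ : ℂ ≃+* ℂ,
      σ • s = (starRingAut : ℂ ≃+* ℂ) • s ∧ σ • t = (starRingAut : ℂ ≃+* ℂ) • t ∧
      ∀ u : K i₀ →+* ℂ, u ≠ s → u ≠ (starRingAut : ℂ ≃+* ℂ) • s → u ≠ t → u ≠ (starRingAut : ℂ ≃+* ℂ) • t →
        σ • u = u)
    (heven : ∀ τ : ℂ ≃+* ℂ,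
      Even (Finset.univ.filter fun x : K i₀ →+* ℂ => x ∈ (Φ i₀).1 ∧ τ • x ∉ (Φ i₀).1).card)
    {ψ₀ : K i₁ →+* ℂ}
    (hψ₀ : ∀ σ : ℂ ≃+* ℂ, σ • ψ₀ = ψ₀ ↔ ∀ x : K i₀ →+* ℂ, σ • x ∈ (Φ i₀).1 ↔ x ∈ (Φ i₀).1)
    (hA : ∀ i, IsCMTypeRealisation (Φ i) (A i) (ι i) (θ i)) (hs : ∀ i, (A i).IsSimple)
    (hniso : ∀ i i', i ≠ i' → ¬ AbelianVariety.IsIsogenous (A i) (A i')) :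
    (∀ (N : ℕ) (π : Fin N → I) (m : ℕ),
      hodgeClassSpan (⨁ fun j : Fin N => A (π j)).dim (⨁ fun j : Fin N => A (π j)).X m =
        divisorClassesSpan (⨁ fun j : Fin N => A (π j)).X (⨁ fun j : Fin N => A (π j)).dim m) ↔
      IsNondegenerate (Φ i₁) := by
  rw [← CMAlgebra.isNondegenerateFamily_iff_forall_prod_hodgeClassSpan_eq
    (CMAlgebra.isSeparatingFamily_of_isSimple_of_pairwise_not_isIsogenous hA hs hniso) hA]
  exact isNondegenerateFamily_iff_of_doubleFlip_reflexOctic hI h01 h8 h8' hflip heven hψ₀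

end Varieties

end Summit.HodgeConjecture.CorCM

end
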